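import Summits.CriticalPhenomena.PercolationContinuityZ3.Theorems.PercNearOneGluingNoHeavyLowerTailSahiC3CubeFiveChunkA
import Summits.CriticalPhenomena.PercolationContinuityZ3.Theorems.PercNearOneGluingNoHeavyLowerTailSahiC3CubeFiveChunkB0
import Summits.CriticalPhenomena.PercolationContinuityZ3.Theorems.PercNearOneGluingNoHeavyLowerTailSahiC3CubeFiveChunkB1
import Summits.CriticalPhenomena.PercolationContinuityZ3.Theorems.PercNearOneGluingNoHeavyLowerTailSahiC3CubeFiveChunkB2
import Summits.CriticalPhenomena.PercolationContinuityZ3.Theorems.PercNearOneGluingNoHeavyLowerTailSahiC3CubeFiveChunkC1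
import Summits.CriticalPhenomena.PercolationContinuityZ3.Theorems.PercNearOneGluingNoHeavyLowerTailSahiC3CubeFiveChunkC2
import Summits.CriticalPhenomena.PercolationContinuityZ3.Theorems.PercNearOneGluingNoHeavyLowerTailSahiC3CubeFiveChunkC3

/-!
# Kahn's Conjecture 5 / Sahi's `C_3` on the cube `{0,1}^5` for EVERY product measure

Support file (cell `prim-sahi`, seat `prim-sahi-typer` gen 27; `--supports stmt-CriticalPhenomena-4575`).  Pure proofs here; the closure is
COMPUTATIONAL through the `native_decide` chunks `colourChunk_five_a/b0/b1/b2/c1/c2/c3` and `colourBase_five` (…`SahiC3CubeFiveChunk*`; the gate's 600 s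
elaboration budget forces pieces of ≤ 13 % of the 25-minute evaluation).

**Theorem `sahiC3_cube_five`.**  For every `p : Fin 5 → [0,1]` and all increasing events `A, B, C ⊆ Set (Fin 5)`:
`0 ≤ E₃(A,B,C) = 2μ(ABC) + μ(A)μ(B)μ(C) − μ(A)μ(BC) − μ(B)μ(AC) − μ(C)μ(AB)`, `μ = prodBernoulli p` — Kahn's Conjecture 5 [Kahn 2022] /
Sahi's Conjecture 5 at `n = 3` [Sahi 2008] for five independent coins, all coordinate probabilities.  The tree had `m ≤ 3` (kernel,
…`SahiC3CubeLeThree`) and `m = 4` (`sahiC3_cube_four`, `native_decide` over the `804 440` sorted triples of increasing bitmasks); at `m = 5`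
there are `≈ 7·10^10` sorted triples.  By the SATURATION REDUCTION (`SahiAbsorbed.sahiPositive_three_of_colouring`) only the `4 061 113` triples
co-generated by the 3-coloured antichains of the `5`-cube need prim-sahi-p1's tensor-Bernstein digit test; `colourCheck 5 19`
(…`SahiC3CubeColourCheck`) runs exactly these, split along the skip chain of its recursion into the chunks by first point
(`colourCheck_of_branches`), and `sahiE3_nonneg_of_colourCheck` is its kernel-checked soundness.  The same fibre sums were found nonnegative
by two independent programs outside Lean (typer gen 27: C `kahncube.c`, kit j167242/j167243; Python Kronecker-digit engine, kit j167324).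
[this work]
-/

namespace Summit.CriticalPhenomena.PercolationContinuityZ3.Theorems.SahiC3Cube

open OneCutCert CovTransferCert
open Literature.Probability.LatticeModels (prodBernoulli sahiE3)

/-- **Assembly along the skip chain**: the all-zero state of `goCC` from point `q` passes if, for every `q' ≥ q`, the three colour branches
with first chosen point `q'` pass, and the empty antichain passes. [this work] -/
theorem goCC_zero_of_branches (σ m : ℕ) (F off : ℤ) (offN : ℕ) :
    ∀ (fuel q : ℕ), q + fuel = 2 ^ m →
      (∀ q', q ≤ q' → q' < 2 ^ m →
        (goCC σ m F off offN (2 ^ m - (q' + 1)) (q' + 1) (0 ||| coneN m q') (0 ||| belowN m q') 0 0 &&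
          goCC σ m F off offN (2 ^ m - (q' + 1)) (q' + 1) (0 ||| coneN m q') 0 (0 ||| belowN m q') 0 &&
            goCC σ m F off offN (2 ^ m - (q' + 1)) (q' + 1) (0 ||| coneN m q') 0 0 (0 ||| belowN m q')) = true) →
      checkTripleW σ m F off offN (memN m 0) (memN m 0) (memN m 0) = true →
      goCC σ m F off offN fuel q 0 0 0 0 = true := by
  intro fuel
  induction fuel with
  | zero => intro q _ _ hbase; exact hbase
  | succ fuel ih =>
    intro q hq hch hbase
    show (goCC σ m F off offN fuel (q + 1) 0 0 0 0 && ((0 : ℕ).testBit q || (_ && _ && _))) = true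
    rw [Bool.and_eq_true]
    refine ⟨ih (q + 1) (by omega) (fun q' h1 h2 => hch q' (by omega) h2) hbase, ?_⟩
    rw [Bool.or_eq_true]
    right
    have hc := hch q le_rfl (by omega)
    have hf : 2 ^ m - (q + 1) = fuel := by omega
    rw [hf] at hc
    exact hc

/-- **`colourCheck` from its chunks**: the side conditions, the colour branches for every first point `q' < 2^m`, and the empty antichain. [this work] -/
theorem colourCheck_of_branches {σ m : ℕ} (hσ : 0 < σ) (hb : 6 * 8 ^ m < 2 ^ (σ - 1))
    (hch : ∀ q', q' < 2 ^ m →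
        (goCC σ m (krT σ m (fullN m)) (offT σ m) (offT σ m).toNat (2 ^ m - (q' + 1)) (q' + 1) (0 ||| coneN m q') (0 ||| belowN m q') 0 0 &&
          goCC σ m (krT σ m (fullN m)) (offT σ m) (offT σ m).toNat (2 ^ m - (q' + 1)) (q' + 1) (0 ||| coneN m q') 0 (0 ||| belowN m q') 0 &&
            goCC σ m (krT σ m (fullN m)) (offT σ m) (offT σ m).toNat (2 ^ m - (q' + 1)) (q' + 1) (0 ||| coneN m q') 0 0 (0 ||| belowN m q')) = true)
    (hbase : checkTripleW σ m (krT σ m (fullN m)) (offT σ m) (offT σ m).toNat (memN m 0) (memN m 0) (memN m 0) = true) :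
    colourCheck m σ = true := by
  unfold colourCheck
  simp only [Bool.and_eq_true, decide_eq_true_eq]
  exact ⟨⟨hσ, hb⟩, goCC_zero_of_branches σ m _ _ _ (2 ^ m) 0 (by simp) (fun q' _ h => hch q' h) hbase⟩

/-- **The coloured-antichain check passes in dimension `5`** (base `2^19`), assembled from the computational chunks. [this work] -/
theorem colourCheck_five : colourCheck 5 19 = true := by
  refine colourCheck_of_branches (by norm_num) (by norm_num) (fun q hq => ?_) colourBase_five
  have ha := List.all_eq_true.1 colourChunk_five_a
  have hc1 := List.all_eq_true.1 colourChunk_five_c1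
  have hc2 := List.all_eq_true.1 colourChunk_five_c2
  have hc3 := List.all_eq_true.1 colourChunk_five_c3
  by_cases h3 : q ∈ ([3] : List ℕ)
  · exact ha q h3
  by_cases h7 : q = 7
  · subst h7
    rw [Bool.and_eq_true, Bool.and_eq_true]
    exact ⟨⟨colourChunk_five_b0, colourChunk_five_b1⟩, colourChunk_five_b2⟩
  by_cases h5 : q ∈ ([5] : List ℕ)
  · exact hc1 q h5
  by_cases h6 : q ∈ ([6, 11] : List ℕ)
  · exact hc2 q h6
  refine hc3 q (List.mem_filter.2 ⟨List.mem_range.2 hq, ?_⟩)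
  simp only [List.mem_cons, List.not_mem_nil, or_false, not_or] at h3 h5 h6
  obtain ⟨h6, h11⟩ := h6
  simp [h3, h5, h6, h11, h7]

/-- **Sahi's `C₃` — Kahn's Conjecture 5 — on `{0,1}⁵` for every product measure** (computational closure through the chunks). [this work] -/
theorem sahiC3_cube_five (p : Fin 5 → unitInterval) {A B C : Set (Set (Fin 5))} (hA : IsUpperSet A) (hB : IsUpperSet B)
    (hC : IsUpperSet C) : 0 ≤ sahiE3 (prodBernoulli p) A B C :=
  sahiE3_nonneg_of_colourCheck colourCheck_five p hA hB hC

/-- `m ≤ 5` packaged: Sahi's `C₃` on `{0,1}^5` in the `KahnConjecture`-style binder shape for `ι = Fin 5`. [this work] -/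
theorem sahiC3_cube_five' : ∀ (p : Fin 5 → unitInterval) (A B C : Set (Set (Fin 5))),
    IsUpperSet A → IsUpperSet B → IsUpperSet C → 0 ≤ sahiE3 (prodBernoulli p) A B C :=
  fun p _ _ _ hA hB hC => sahiC3_cube_five p hA hB hC

end Summit.CriticalPhenomena.PercolationContinuityZ3.Theorems.SahiC3Cube
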